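import Summits.CriticalPhenomena.PercolationContinuityZ3.Theorems.SahiMasterFamilySectionExpansion
import Literature.Combinatorics.Sahi2008.GeneratingFunction
import Literature.Combinatorics.Sahi2008.FKGCumulation

/-!
# The OR-shape at every order, 0: square-free plumbing

Unit `prim-master-conj` (crux anchor stmt-CriticalPhenomena-4575, helper work), gen 17; memo
`run/shared/lean/prim/prim-l12/prim-master-conj/POINTWISE.md` §18.  Small public wrappers around the (file-private) API of the tree's
square-free algebra `SqFree` [Sahi2008, §3.3] in `Literature/Combinatorics/Sahi2008/CumulationCone.lean` (accessed with `open private`, as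
`Sahi2008/FKGCumulation.lean` and `…PhiScale` do): exponent laws of the binomial powers `binomB c u = (1−u)^c`, nilpotency, the cone `𝒫` of
elements with nonnegative coefficients (`SqFree.Nonneg`) and the **second-order binomial remainder**
`1 − s·r − (1−r)^s = Σ_{k≥2} (−1)^{k−1}C(s,k) r^k ∈ 𝒫` for `0 ≤ s ≤ 1`, `r ∈ 𝒫` nil (`nonneg_one_sub_smul_sub_binomB`), the positivity
mechanism of the OR-shape theorem (`…OrShapeDomination`).  Everything is [folklore]; axioms standard.
-/

set_option autoImplicit false

open Finset

open private SqFree.ext coeff_add coeff_sub coeff_one coeff_mul coeff_sum coeff_single coeff_C_mul coeff_C coeff_neg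
  isNil_single isNil_lin IsNil.add IsNil.sub IsNil.mul_left IsNil.neg IsNil.sum IsNil.emb
  binomB_mul_binomB binomB_mul_binomB_same binomB_one_sub_binomB isNil_one_sub_binomB coeff_empty_binomB
  binomB_zero_right binomB_zero_left binomB_one_left binomB_sub_one prod_binomB_eq_binomB_sum
  prod_binomB_add_sqzero lin_cons emb_binomB emb_inv1 coeff_univ_single_zero_mul_emb coeff_emb_univ
  C_mul_single single_mul_single_self one_sub_mul_inv1 inv1_mul_one_sub mul_inv1 C_apply rch_one
  from Literature.Combinatorics.Sahi2008.CumulationCone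

noncomputable section

open scoped Classical

namespace Summit.CriticalPhenomena.PercolationContinuityZ3.Theorems

namespace OrShape

open Function
open Literature.Combinatorics.Sahi2008
open Literature.Combinatorics.Sahi2008.SqFree
open Literature.Probability.Percolation.DecisionTree (ind ind_of_mem ind_of_not_mem ind_nonneg)

/-! ### Square-free plumbing -/

section Sq

variable {κ : Type*} [DecidableEq κ] [Fintype κ]

omit [Fintype κ] in
/-- Top coefficient of a constant multiple. [folklore] -/
theorem coeff_C_mul' (r : ℝ) (a : SqFree κ ℝ) (τ : Finset κ) : (C r * a).coeff τ = r * a.coeff τ := coeff_C_mul r a τ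

omit [Fintype κ] in
/-- Coefficients of a finite sum. [folklore] -/
theorem coeff_sum' {β : Type*} (s : Finset β) (g : β → SqFree κ ℝ) (τ : Finset κ) :
    (∑ x ∈ s, g x).coeff τ = ∑ x ∈ s, (g x).coeff τ := coeff_sum s g τ

/-- `(1−u)(1−u)⁻¹ = 1` for nil `u`. [folklore] -/
theorem one_sub_mul_inv1' {u : SqFree κ ℝ} (hu : u.IsNil) : (1 - u) * inv1 u = 1 := one_sub_mul_inv1 hu

/-- `(1−u)^{−1} = (1−u)⁻¹`. [folklore] -/
theorem binomB_neg_one {u : SqFree κ ℝ} (hu : u.IsNil) : binomB (-1 : ℝ) u = inv1 u := by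
  have h := binomB_sub_one hu (0 : ℝ)
  rw [zero_sub, binomB_zero_left, one_mul] at h
  exact h

/-- Exponent additivity: `(1−u)^a (1−u)^b = (1−u)^{a+b}`. [folklore] -/
theorem binomB_mul_same {u : SqFree κ ℝ} (hu : u.IsNil) (a b : ℝ) : binomB a u * binomB b u = binomB (a + b) u :=
  binomB_mul_binomB_same hu a b

/-- Base multiplicativity: `(1−u)^c (1−v)^c = (1 − (u + v − uv))^c`. [folklore] -/
theorem binomB_mul_base {u v : SqFree κ ℝ} (hu : u.IsNil) (hv : v.IsNil) (c : ℝ) :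
    binomB c u * binomB c v = binomB c (u + v - u * v) := binomB_mul_binomB hu hv c

/-- Composition: `(1 − (1 − (1−u)^s))^c = (1−u)^{cs}`. [folklore] -/
theorem binomB_comp {u : SqFree κ ℝ} (hu : u.IsNil) (c s : ℝ) : binomB c (1 - binomB s u) = binomB (c * s) u :=
  binomB_one_sub_binomB hu c s

/-- `∏_x (1−u)^{c_x} = (1−u)^{Σ c_x}`. [folklore] -/
theorem prod_binomB_same {β : Type*} (s : Finset β) (c : β → ℝ) {u : SqFree κ ℝ} (hu : u.IsNil) :
    ∏ x ∈ s, binomB (c x) u = binomB (∑ x ∈ s, c x) u := prod_binomB_eq_binomB_sum s c hu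

/-- `(1−u)^0 = 1`. [folklore] -/
theorem binomB_zero_left' (u : SqFree κ ℝ) : binomB (0 : ℝ) u = 1 := binomB_zero_left u

/-- `(1−u)^1 = 1 − u`. [folklore] -/
theorem binomB_one_left' {u : SqFree κ ℝ} (hu : u.IsNil) : binomB (1 : ℝ) u = 1 - u := binomB_one_left hu

/-- `1 − (1−u)^s` is nil. [folklore] -/
theorem isNil_one_sub_binomB' {u : SqFree κ ℝ} (hu : u.IsNil) (s : ℝ) : (1 - binomB s u).IsNil := isNil_one_sub_binomB hu s

omit [Fintype κ] in
/-- A product with a nil left factor is nil. [folklore] -/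
theorem isNil_mul_left {a : SqFree κ ℝ} (ha : a.IsNil) (b : SqFree κ ℝ) : (a * b).IsNil := IsNil.mul_left ha b

omit [Fintype κ] in
/-- Sums of nil elements are nil. [folklore] -/
theorem isNil_sum {β : Type*} {s : Finset β} {g : β → SqFree κ ℝ} (h : ∀ x ∈ s, (g x).IsNil) : (∑ x ∈ s, g x).IsNil :=
  IsNil.sum h

omit [Fintype κ] in
/-- Difference of monomials on the same support. [folklore] -/
theorem single_sub' (σ : Finset κ) (r r' : ℝ) : single σ r - single σ r' = single σ (r - r') :=
  SqFree.ext fun τ => by rw [coeff_sub, coeff_single, coeff_single, coeff_single]; split_ifs <;> ring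

omit [Fintype κ] in
/-- A monomial of positive degree is nil. [folklore] -/
theorem isNil_single' {σ : Finset κ} (hσ : σ.Nonempty) (r : ℝ) : (single σ r).IsNil := isNil_single hσ r

/-! #### Nonnegative coefficients -/

omit [Fintype κ] in
/-- `𝒫` is closed under products. [folklore] -/
theorem nonneg_mul {a b : SqFree κ ℝ} (ha : a.Nonneg) (hb : b.Nonneg) : (a * b).Nonneg := fun τ => by
  rw [coeff_mul]; exact Finset.sum_nonneg fun σ _ => mul_nonneg (ha σ) (hb _)

omit [Fintype κ] in
/-- `𝒫` is closed under finite sums. [folklore] -/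
theorem nonneg_sum {β : Type*} {s : Finset β} {g : β → SqFree κ ℝ} (h : ∀ x ∈ s, (g x).Nonneg) :
    (∑ x ∈ s, g x).Nonneg := fun τ => by
  rw [coeff_sum]; exact Finset.sum_nonneg fun x hx => h x hx τ

omit [Fintype κ] in
/-- `1 ∈ 𝒫`. [folklore] -/
theorem nonneg_one : (1 : SqFree κ ℝ).Nonneg := fun τ => by
  rw [coeff_one]; split_ifs <;> norm_num

omit [Fintype κ] in
/-- `𝒫` is closed under finite products. [folklore] -/
theorem nonneg_prod {β : Type*} {s : Finset β} {g : β → SqFree κ ℝ} (h : ∀ x ∈ s, (g x).Nonneg) :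
    (∏ x ∈ s, g x).Nonneg := by
  induction s using Finset.cons_induction with
  | empty => rw [Finset.prod_empty]; exact nonneg_one
  | cons x s hx ih =>
    rw [Finset.prod_cons]
    exact nonneg_mul (h x (Finset.mem_cons_self x s)) (ih fun y hy => h y (Finset.mem_cons_of_mem hy))

omit [Fintype κ] in
/-- `𝒫` is closed under powers. [folklore] -/
theorem nonneg_pow {a : SqFree κ ℝ} (ha : a.Nonneg) : ∀ k : ℕ, (a ^ k).Nonneg
  | 0 => by rw [pow_zero]; exact nonneg_one
  | k + 1 => by rw [pow_succ]; exact nonneg_mul (nonneg_pow ha k) ha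

omit [Fintype κ] in
/-- Nonnegative constants lie in `𝒫`. [folklore] -/
theorem nonneg_C {r : ℝ} (hr : 0 ≤ r) : (C r : SqFree κ ℝ).Nonneg := fun τ => by
  rw [coeff_C]; split_ifs <;> [exact hr; exact le_rfl]

omit [Fintype κ] in
/-- Monomials with nonnegative coefficient lie in `𝒫`. [folklore] -/
theorem nonneg_single (σ : Finset κ) {r : ℝ} (hr : 0 ≤ r) : (single σ r).Nonneg := fun τ => by
  rw [coeff_single]; split_ifs <;> [exact hr; exact le_rfl]

/-- `(1−u)⁻¹ ∈ 𝒫` for `u ∈ 𝒫`. [folklore] -/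
theorem nonneg_inv1 {u : SqFree κ ℝ} (hu : u.Nonneg) : (inv1 u).Nonneg :=
  nonneg_sum fun j _ => nonneg_pow hu j

omit [DecidableEq κ] in
/-- Over an empty index type a nil element vanishes. [folklore] -/
theorem eq_zero_of_isNil_of_card_eq_zero (hκ : Fintype.card κ = 0) {a : SqFree κ ℝ} (ha : a.IsNil) : a = 0 := by
  haveI : IsEmpty κ := Fintype.card_eq_zero_iff.mp hκ
  refine SqFree.ext fun τ => ?_
  rw [Finset.eq_empty_of_isEmpty τ]
  exact ha

/-- **Second-order binomial remainder**: for `0 ≤ s ≤ 1` and a nil `r ∈ 𝒫`,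
`1 − s·r − (1−r)^s = Σ_{k≥2} (−1)^{k−1} C(s,k) r^k ∈ 𝒫`. [folklore; cf. Sahi2008, proof of Lemma 16 (p. 225)] -/
theorem nonneg_one_sub_smul_sub_binomB {s : ℝ} (h0 : 0 ≤ s) (h1 : s ≤ 1) {r : SqFree κ ℝ} (hr0 : r.IsNil)
    (hr : r.Nonneg) : (1 - C s * r - binomB s r).Nonneg := by
  cases hκ : Fintype.card κ with
  | zero =>
    rw [eq_zero_of_isNil_of_card_eq_zero hκ hr0, mul_zero, sub_zero, binomB_zero_right, sub_self]
    exact fun τ => le_rfl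
  | succ N =>
    rw [binomB_eq_one_sub, hκ, Finset.sum_range_succ' _ N]
    have hT0 : C ((-1 : ℝ) ^ 0 * rch (0 + 1) s) * r ^ (0 + 1) = C s * r := by
      rw [pow_zero, one_mul, zero_add, pow_one, rch_one]
    rw [hT0]
    have e : (1 : SqFree κ ℝ) - C s * r -
        (1 - (∑ k ∈ range N, C ((-1 : ℝ) ^ (k + 1) * rch (k + 1 + 1) s) * r ^ (k + 1 + 1) + C s * r)) =
        ∑ k ∈ range N, C ((-1 : ℝ) ^ (k + 1) * rch (k + 1 + 1) s) * r ^ (k + 1 + 1) := by ring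
    rw [e]
    exact nonneg_sum fun k _ => nonneg_mul (nonneg_C (neg_one_pow_mul_rch_succ_nonneg h0 h1 (k + 1))) (nonneg_pow hr _)

end Sq

end OrShape
end Summit.CriticalPhenomena.PercolationContinuityZ3.Theorems
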